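import Summits.AnomalousDissipation.AnomalousDissipation.Theorems.SolenoidalFractalHomogenisationLagrangianStepSidebandXDefectCommutator
import HarnessLib

/-!
# K1L_D `LagrangianRenormalisationStepDesign` (stmt-AnomalousDissipation-27980), `stub_D1_V0` (V0 = clause (ii) of
# `WCrossing.D1ExactFamily`), brick T4c-3b (bounds): THE LINK PART OF THE COMMUTATOR DEFECT IS `O(|ξ|)` PER NEIGHBOUR, UNIFORMLY IN THE CLASS POINT
# (helper; `--kind proof --supports stmt-AnomalousDissipation-27980 --as helper`)

Summits-side helper file of route `SolenoidalFractalHomogenisation` (prover seat `ad-k1l-cellLawV-w1` g6).  Everything proved; no definitions, no named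
facts, no sorry.  Bounds for the two link groups of `…SidebandXDefectCommutator.genX_projX_sub_projX_gen_apply` (memo
`Cruxes/LagrangianRenormalisationStepDesign/Lines/onelevel-V0-residual.md` §3, D1 links), `ξ := √|ℓ|²/n`, `2√|ℓ|² ≤ n`:
* `norm_sum_e_mul_le` (`|êⱼ·k| ≤ |k|`), `norm_linkCoeff_one_le` (`|linkCoeffⱼ¹(z)| ≤ 2π|z|`), `norm_linkCoeff_slow_le` (`|linkCoeffⱼ(ℓ)| ≤ 2πξ`),
  `sqrt_freqNormSq_classFreq_ge` (`|k_w| ≥ n|w| − |ℓ|`);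
* **`norm_proj_commutator_le`** — for a retained neighbour `w ∈ box R` and any `v`:
  `‖P_{k_z}(P_{k_w} v − P_z (P_w v))‖ ≤ ξ·(3/|w| + 1/|z|)·‖v‖` (three elementary projection estimates of `…DefectAlgebra` / `…DefectCommutator`);
* **`norm_slow_link_le`** — `‖linkCoeffⱼ(ℓ,t) • P_{k_z}(αⱼ P_{k⁻} y⁻ + ᾱⱼ P_{k⁺} y⁺)‖ ≤ 2πξ‖αⱼ‖(‖y⁻‖ + ‖y⁺‖)`;
* **`norm_link_commutator_le`** — `‖linkCoeffⱼ¹(z,t) • P_{k_z}(αⱼ(P_{k⁻}y⁻ − P_zP_{z−mⱼ}y⁻) + ᾱⱼ(P_{k⁺}y⁺ − P_zP_{z+mⱼ}y⁺))‖ ≤ 2πξ‖αⱼ‖(4 + 3|mⱼ|)(‖y⁻‖ + ‖y⁺‖)` —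
  the `|z|`-growth of `linkCoeffⱼ¹(z)` is exactly compensated (`|z|/|z ∓ mⱼ| ≤ 1 + |mⱼ|`, `|z|·(1/|z|) = 1`), so the link defect is `O(|ξ|)·‖y‖` in `ℓ²`
  uniformly up to the truncation radius `R0 ν = ν⁻³`.
NOT a proof of any registered stub, of K1L_D, or of anomalous dissipation; rung F-D1.A0 infrastructure.
-/

set_option linter.dupNamespace false

noncomputable section

namespace Summit.AnomalousDissipation.AnomalousDissipation.Theorems.SolenoidalFractalHomogenisation.LagrangianStep.Sideband

open Set MeasureTheory Complex UnitAddTorus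
open scoped InnerProductSpace
open Literature.Analysis Literature.Analysis.FunctionSpaces Literature.Analysis.FunctionSpaces.Torus
open Literature.Analysis.FluidPDE Literature.Analysis.FluidPDE.Torus Literature.Analysis.FluidPDE.LatticeShear
open Summit.AnomalousDissipation.AnomalousDissipation.Theorems.SolenoidalFractalHomogenisation.LagrangianStep.CellChain
  (linkCoeff linkCoeff_def norm_linkCoeff_le norm_transversalProj_le)

variable {k₀ : ℕ}

/-! ## §1 Sizes of the link coefficients and of the class frequencies -/

/-- `|êⱼ·k| ≤ |k|` (`‖ê‖ = 1`, Cauchy–Schwarz). [folklore] -/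
theorem norm_sum_e_mul_le (P : LatticePhase) (k : Fin 3 → ℤ) :
    ‖∑ a, ((P.e a : ℝ) : ℂ) * ((k a : ℤ) : ℂ)‖ ≤ Real.sqrt (freqNormSq k) := by
  have hcast : ∑ a, ((P.e a : ℝ) : ℂ) * ((k a : ℤ) : ℂ) = ((∑ a, P.e a * (k a : ℝ) : ℝ) : ℂ) := by push_cast; rfl
  rw [hcast, Complex.norm_real, Real.norm_eq_abs]
  have hcs : (∑ a, P.e a * (k a : ℝ)) ^ 2 ≤ (∑ a, (P.e a) ^ 2) * ∑ a, ((k a : ℤ) : ℝ) ^ 2 := Finset.sum_mul_sq_le_sq_mul_sq _ _ _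
  have he : ∑ a, (P.e a) ^ 2 = 1 := by
    have h := P.e_unit
    have h2 : ‖P.e‖ ^ 2 = ∑ a, (P.e a) ^ 2 := by
      rw [EuclideanSpace.norm_sq_eq]; exact Finset.sum_congr rfl fun a _ => by rw [Real.norm_eq_abs, sq_abs]
    rw [← h2, h, one_pow]
  rw [he, one_mul, ← freqNormSq] at hcs
  exact ThreeMode.abs_le_of_sq_le_sq'' (by rwa [Real.sq_sqrt (freqNormSq_nonneg k)]) (Real.sqrt_nonneg _)

/-- `|linkCoeffⱼ¹(z,t)| ≤ 2π|z|` (the integer-lattice coefficient of `Sideband.gen`). [cite: MeshalkinSinai1961, pp. 1700–1705] -/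
theorem norm_linkCoeff_one_le (W₁ : LatticeWord k₀) (z : Fin 3 → ℤ) (j : Fin k₀) (t : ℝ) :
    ‖linkCoeff W₁ 1 z j t‖ ≤ 2 * Real.pi * Real.sqrt (freqNormSq z) := by
  have h := norm_linkCoeff_le W₁ 1 z j t
  simp only [Nat.cast_one, div_one, mul_one] at h
  exact h.trans (mul_le_mul_of_nonneg_left (norm_sum_e_mul_le _ _) (by positivity))

/-- `|linkCoeffⱼ(ℓ,t)| ≤ 2π|ℓ|/n = 2πξ` (the slow coefficient). [cite: MeshalkinSinai1961, pp. 1700–1705] -/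
theorem norm_linkCoeff_slow_le (W₁ : LatticeWord k₀) (n : ℕ) (ℓ : Fin 3 → ℤ) (j : Fin k₀) (t : ℝ) :
    ‖linkCoeff W₁ n ℓ j t‖ ≤ 2 * Real.pi * (Real.sqrt (freqNormSq ℓ) / n) := by
  have h := norm_linkCoeff_le W₁ n ℓ j t
  calc ‖linkCoeff W₁ n ℓ j t‖ ≤ 2 * Real.pi * ‖∑ a, ((W₁.phase j).e a : ℂ) * (ℓ a)‖ * (1 / (n : ℝ)) := h
    _ ≤ 2 * Real.pi * Real.sqrt (freqNormSq ℓ) * (1 / (n : ℝ)) :=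
        mul_le_mul_of_nonneg_right (mul_le_mul_of_nonneg_left (norm_sum_e_mul_le _ _) (by positivity)) (by positivity)
    _ = 2 * Real.pi * (Real.sqrt (freqNormSq ℓ) / n) := by ring

/-- `waveVecC k_w = waveVecC ℓ + n • waveVecC w`. [folklore] -/
theorem waveVecC_classFreq (n : ℕ) (ℓ w : Fin 3 → ℤ) : waveVecC (classFreq n ℓ w) = waveVecC ℓ + (n : ℂ) • waveVecC w := by
  ext i; simp [waveVecC_apply, classFreq_apply]

/-- **`|k_w| ≥ n|w| − |ℓ|`**. [folklore] -/
theorem sqrt_freqNormSq_classFreq_ge (n : ℕ) (ℓ w : Fin 3 → ℤ) :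
    (n : ℝ) * Real.sqrt (freqNormSq w) - Real.sqrt (freqNormSq ℓ) ≤ Real.sqrt (freqNormSq (classFreq n ℓ w)) := by
  rw [← norm_waveVecC, ← norm_waveVecC, ← norm_waveVecC, waveVecC_classFreq]
  have h := norm_sub_norm_le ((n : ℂ) • waveVecC w) (-(waveVecC ℓ))
  rw [norm_neg, sub_neg_eq_add, add_comm, norm_smul] at h
  have hn : ‖(n : ℂ)‖ = (n : ℝ) := by simp
  rw [hn] at h
  linarith

/-! ## §2 The projection commutator of one neighbour -/

/-- **`‖P_{k_z}(P_{k_w} v − P_z (P_w v))‖ ≤ ξ·(3/|w| + 1/|z|)·‖v‖`** for a retained neighbour `w ∈ box R`, `z ∈ box R`, `2|ℓ| ≤ n`, any `v`.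
[cite: Temam1984, Ch. III §1.1] -/
theorem norm_proj_commutator_le {n : ℕ} (hn : n ≠ 0) {ℓ : Fin 3 → ℤ} (hℓ : 2 * Real.sqrt (freqNormSq ℓ) ≤ n) {R : ℕ}
    (z : box R) {w : Fin 3 → ℤ} (hw : w ∈ box R) (v : EuclideanSpace ℂ (Fin 3)) :
    ‖transversalProj (classFreq n ℓ z.1) (transversalProj (classFreq n ℓ w) v - transversalProj z.1 (transversalProj w v))‖ ≤
      (Real.sqrt (freqNormSq ℓ) / n) * (3 / Real.sqrt (freqNormSq w) + 1 / Real.sqrt (freqNormSq z.1)) * ‖v‖ := by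
  have hw0 : w ≠ 0 := ne_zero_of_mem_box hw
  have hz0 : (z : Fin 3 → ℤ) ≠ 0 := ne_zero_of_mem_box z.2
  have hn0 : (0 : ℝ) < n := by exact_mod_cast Nat.pos_of_ne_zero hn
  set ξ := Real.sqrt (freqNormSq ℓ) / n with hξ
  have hξ0 : 0 ≤ ξ := by positivity
  have hW : 1 ≤ Real.sqrt (freqNormSq w) := by
    rw [← Real.sqrt_one]; exact Real.sqrt_le_sqrt (Torus.one_le_freqNormSq_of_ne_zero hw0)
  have hZ : 1 ≤ Real.sqrt (freqNormSq z.1) := by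
    rw [← Real.sqrt_one]; exact Real.sqrt_le_sqrt (Torus.one_le_freqNormSq_of_ne_zero hz0)
  have hW0 : 0 < Real.sqrt (freqNormSq w) := by linarith
  have hZ0 : 0 < Real.sqrt (freqNormSq z.1) := by linarith
  -- the class base points
  have hnw : classFreq n 0 w ≠ 0 := by
    intro h; apply hw0; funext i; have := congrFun h i
    simp only [classFreq_zero_left, Pi.zero_apply, mul_eq_zero, Int.natCast_eq_zero] at this; exact this.resolve_left hn
  have hkw : classFreq n ℓ w ≠ 0 := by
    intro h
    have h1 := sqrt_freqNormSq_classFreq_ge n ℓ w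
    rw [h, show freqNormSq (0 : Fin 3 → ℤ) = 0 by simp [freqNormSq], Real.sqrt_zero] at h1
    nlinarith [mul_le_mul_of_nonneg_left hW hn0.le]
  have hsqw : Real.sqrt (freqNormSq (classFreq n 0 w)) = n * Real.sqrt (freqNormSq w) := by
    rw [freqNormSq_classFreq_zero, Real.sqrt_mul (sq_nonneg _), Real.sqrt_sq hn0.le]
  have hsqz : Real.sqrt (freqNormSq (classFreq n 0 z.1)) = n * Real.sqrt (freqNormSq z.1) := by
    rw [freqNormSq_classFreq_zero, Real.sqrt_mul (sq_nonneg _), Real.sqrt_sq hn0.le]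
  have hkwge : (n : ℝ) * Real.sqrt (freqNormSq w) / 2 ≤ Real.sqrt (freqNormSq (classFreq n ℓ w)) := by
    have h1 := sqrt_freqNormSq_classFreq_ge n ℓ w
    have : Real.sqrt (freqNormSq ℓ) ≤ (n : ℝ) * Real.sqrt (freqNormSq w) / 2 := by nlinarith [mul_le_mul_of_nonneg_left hW hn0.le]
    linarith
  -- (1) `‖P_{k_w}(v − P_w v)‖ ≤ ξ/|w| ‖v‖`
  have h1 : ‖transversalProj (classFreq n ℓ w) (v - transversalProj w v)‖ ≤ ξ / Real.sqrt (freqNormSq w) * ‖v‖ := by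
    rw [← transversalProj_classFreq_zero hn w v]
    have h := norm_transversalProj_sub_proj_le (classFreq n ℓ w) hnw v
    rw [classFreq_sub_classFreq_zero, hsqw] at h
    calc _ ≤ Real.sqrt (freqNormSq ℓ) / (n * Real.sqrt (freqNormSq w)) * ‖v‖ := h
      _ = ξ / Real.sqrt (freqNormSq w) * ‖v‖ := by rw [hξ, div_div]
  -- (2) `‖P_w v − P_{k_w} P_w v‖ ≤ 2ξ/|w| ‖v‖`
  have h2 : ‖transversalProj w v - transversalProj (classFreq n ℓ w) (transversalProj w v)‖ ≤ 2 * ξ / Real.sqrt (freqNormSq w) * ‖v‖ := by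
    rw [← transversalProj_classFreq_zero hn w v]
    have h := norm_sub_transversalProj_proj_le hkw (classFreq n 0 w) v
    rw [classFreq_sub_classFreq_zero] at h
    refine h.trans (mul_le_mul_of_nonneg_right ?_ (norm_nonneg _))
    rw [div_le_div_iff₀ (lt_of_lt_of_le (by positivity) hkwge) hW0, hξ]
    have : Real.sqrt (freqNormSq ℓ) * Real.sqrt (freqNormSq w) ≤ 2 * (Real.sqrt (freqNormSq ℓ) / n) * ((n : ℝ) * Real.sqrt (freqNormSq w) / 2) := by
      field_simp; exact le_refl _
    exact this.trans (mul_le_mul_of_nonneg_left hkwge (by positivity))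
  -- (3) `‖P_{k_z}(u − P_z u)‖ ≤ ξ/|z| ‖u‖`, `u = P_w v`
  have h3 : ‖transversalProj (classFreq n ℓ z.1) (transversalProj w v - transversalProj z.1 (transversalProj w v))‖ ≤
      ξ / Real.sqrt (freqNormSq z.1) * ‖v‖ := by
    rw [← transversalProj_classFreq_zero hn z.1 (transversalProj w v)]
    have hnz : classFreq n 0 z.1 ≠ 0 := by
      intro h; apply hz0; funext i; have := congrFun h i
      simp only [classFreq_zero_left, Pi.zero_apply, mul_eq_zero, Int.natCast_eq_zero] at this; exact this.resolve_left hn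
    have h := norm_transversalProj_sub_proj_le (classFreq n ℓ z.1) hnz (transversalProj w v)
    rw [classFreq_sub_classFreq_zero, hsqz] at h
    calc _ ≤ Real.sqrt (freqNormSq ℓ) / (n * Real.sqrt (freqNormSq z.1)) * ‖transversalProj w v‖ := h
      _ ≤ Real.sqrt (freqNormSq ℓ) / (n * Real.sqrt (freqNormSq z.1)) * ‖v‖ :=
          mul_le_mul_of_nonneg_left (norm_transversalProj_le _ _) (by positivity)
      _ = ξ / Real.sqrt (freqNormSq z.1) * ‖v‖ := by rw [hξ, div_div]
  -- assemble
  have hsplit : transversalProj (classFreq n ℓ z.1) (transversalProj (classFreq n ℓ w) v - transversalProj z.1 (transversalProj w v))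
      = transversalProj (classFreq n ℓ z.1) (transversalProj (classFreq n ℓ w) (v - transversalProj w v))
        - transversalProj (classFreq n ℓ z.1) (transversalProj w v - transversalProj (classFreq n ℓ w) (transversalProj w v))
        + transversalProj (classFreq n ℓ z.1) (transversalProj w v - transversalProj z.1 (transversalProj w v)) := by
    simp only [map_sub]; abel
  rw [hsplit]
  calc ‖transversalProj (classFreq n ℓ z.1) (transversalProj (classFreq n ℓ w) (v - transversalProj w v))
        - transversalProj (classFreq n ℓ z.1) (transversalProj w v - transversalProj (classFreq n ℓ w) (transversalProj w v))
        + transversalProj (classFreq n ℓ z.1) (transversalProj w v - transversalProj z.1 (transversalProj w v))‖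
      ≤ ‖transversalProj (classFreq n ℓ z.1) (transversalProj (classFreq n ℓ w) (v - transversalProj w v))‖
        + ‖transversalProj (classFreq n ℓ z.1) (transversalProj w v - transversalProj (classFreq n ℓ w) (transversalProj w v))‖
        + ‖transversalProj (classFreq n ℓ z.1) (transversalProj w v - transversalProj z.1 (transversalProj w v))‖ :=
        (norm_add_le _ _).trans (add_le_add (norm_sub_le _ _) le_rfl)
    _ ≤ ξ / Real.sqrt (freqNormSq w) * ‖v‖ + 2 * ξ / Real.sqrt (freqNormSq w) * ‖v‖ + ξ / Real.sqrt (freqNormSq z.1) * ‖v‖ := by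
        gcongr
        · exact (norm_transversalProj_le _ _).trans h1
        · exact (norm_transversalProj_le _ _).trans h2
    _ = (Real.sqrt (freqNormSq ℓ) / n) * (3 / Real.sqrt (freqNormSq w) + 1 / Real.sqrt (freqNormSq z.1)) * ‖v‖ := by
        rw [hξ]; ring

/-! ## §3 The two link groups -/

/-- **Slow-coefficient group**: `‖linkCoeffⱼ(ℓ,t) • P_{k_z}(αⱼ P_{k⁻} y⁻ + ᾱⱼ P_{k⁺} y⁺)‖ ≤ 2πξ‖αⱼ‖(‖y⁻‖ + ‖y⁺‖)`. [cite: MeshalkinSinai1961, pp. 1700–1705] -/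
theorem norm_slow_link_le (W₁ : LatticeWord k₀) (n : ℕ) (ℓ : Fin 3 → ℤ) {R : ℕ} (j : Fin k₀) (t : ℝ) (y : Space R) (z : box R) :
    ‖linkCoeff W₁ n ℓ j t • transversalProj (classFreq n ℓ z.1)
        (slotAmp W₁ j • transversalProj (classFreq n ℓ (z.1 - (W₁.phase j).m)) (coordL R (z.1 - (W₁.phase j).m) y) +
          starRingEnd ℂ (slotAmp W₁ j) • transversalProj (classFreq n ℓ (z.1 + (W₁.phase j).m)) (coordL R (z.1 + (W₁.phase j).m) y))‖ ≤
      2 * Real.pi * (Real.sqrt (freqNormSq ℓ) / n) * ‖slotAmp W₁ j‖ *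
        (‖coordL R (z.1 - (W₁.phase j).m) y‖ + ‖coordL R (z.1 + (W₁.phase j).m) y‖) := by
  have hlc := norm_linkCoeff_slow_le W₁ n ℓ j t
  have hα : ‖starRingEnd ℂ (slotAmp W₁ j)‖ = ‖slotAmp W₁ j‖ := Complex.norm_conj _
  rw [norm_smul]
  have hin : ‖transversalProj (classFreq n ℓ z.1)
        (slotAmp W₁ j • transversalProj (classFreq n ℓ (z.1 - (W₁.phase j).m)) (coordL R (z.1 - (W₁.phase j).m) y) +
          starRingEnd ℂ (slotAmp W₁ j) • transversalProj (classFreq n ℓ (z.1 + (W₁.phase j).m)) (coordL R (z.1 + (W₁.phase j).m) y))‖ ≤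
      ‖slotAmp W₁ j‖ * (‖coordL R (z.1 - (W₁.phase j).m) y‖ + ‖coordL R (z.1 + (W₁.phase j).m) y‖) := by
    refine (norm_transversalProj_le _ _).trans ((norm_add_le _ _).trans ?_)
    rw [norm_smul, norm_smul, hα, mul_add]
    gcongr <;> exact norm_transversalProj_le _ _
  calc _ ≤ (2 * Real.pi * (Real.sqrt (freqNormSq ℓ) / n)) * (‖slotAmp W₁ j‖ * (‖coordL R (z.1 - (W₁.phase j).m) y‖ + ‖coordL R (z.1 + (W₁.phase j).m) y‖)) :=
        mul_le_mul hlc hin (norm_nonneg _) (by positivity)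
    _ = _ := by ring

/-- One neighbour of the commutator group with the `|z|`-compensation: for `w = z ∓ mⱼ`,
`2π|z|·‖P_{k_z}(P_{k_w} coordL_w y − P_z P_w coordL_w y)‖ ≤ 2πξ(4 + 3|mⱼ|)‖coordL_w y‖` (`|z|/|w| ≤ 1 + |mⱼ|` when `w` is retained; `0` otherwise).
[cite: Temam1984, Ch. III §1.1] -/
theorem norm_neighbour_commutator_le {n : ℕ} (hn : n ≠ 0) {ℓ : Fin 3 → ℤ} (hℓ : 2 * Real.sqrt (freqNormSq ℓ) ≤ n) {R : ℕ}
    (z : box R) (w m : Fin 3 → ℤ) (hzw : z.1 = w + m ∨ z.1 = w - m) (y : Space R) :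
    2 * Real.pi * Real.sqrt (freqNormSq z.1) *
        ‖transversalProj (classFreq n ℓ z.1) (transversalProj (classFreq n ℓ w) (coordL R w y) - transversalProj z.1 (transversalProj w (coordL R w y)))‖ ≤
      2 * Real.pi * (Real.sqrt (freqNormSq ℓ) / n) * (4 + 3 * Real.sqrt (freqNormSq m)) * ‖coordL R w y‖ := by
  by_cases hw : w ∈ box R
  · have hw0 : w ≠ 0 := ne_zero_of_mem_box hw
    have hW : 1 ≤ Real.sqrt (freqNormSq w) := by
      rw [← Real.sqrt_one]; exact Real.sqrt_le_sqrt (Torus.one_le_freqNormSq_of_ne_zero hw0)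
    have hZ : 1 ≤ Real.sqrt (freqNormSq z.1) := by
      rw [← Real.sqrt_one]; exact Real.sqrt_le_sqrt (Torus.one_le_freqNormSq_of_ne_zero (ne_zero_of_mem_box z.2))
    have hW0 : 0 < Real.sqrt (freqNormSq w) := by linarith
    have hZ0 : 0 < Real.sqrt (freqNormSq z.1) := by linarith
    have h := norm_proj_commutator_le hn hℓ z hw (coordL R w y)
    -- `|z| ≤ |w| + |m|`
    have hzle : Real.sqrt (freqNormSq z.1) ≤ Real.sqrt (freqNormSq w) + Real.sqrt (freqNormSq m) := by
      rw [← norm_waveVecC, ← norm_waveVecC, ← norm_waveVecC]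
      rcases hzw with h1 | h1
      · have : waveVecC z.1 = waveVecC w + waveVecC m := by ext i; simp [waveVecC_apply, h1]
        rw [this]; exact norm_add_le _ _
      · have : waveVecC z.1 = waveVecC w - waveVecC m := by ext i; simp [waveVecC_apply, h1]
        rw [this]; exact norm_sub_le _ _
    have hratio : Real.sqrt (freqNormSq z.1) / Real.sqrt (freqNormSq w) ≤ 1 + Real.sqrt (freqNormSq m) := by
      rw [div_le_iff₀ hW0]
      nlinarith [Real.sqrt_nonneg (freqNormSq m)]
    set ξ := Real.sqrt (freqNormSq ℓ) / n
    have hξ0 : 0 ≤ ξ := by positivity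
    calc 2 * Real.pi * Real.sqrt (freqNormSq z.1) *
          ‖transversalProj (classFreq n ℓ z.1) (transversalProj (classFreq n ℓ w) (coordL R w y) - transversalProj z.1 (transversalProj w (coordL R w y)))‖
        ≤ 2 * Real.pi * Real.sqrt (freqNormSq z.1) * (ξ * (3 / Real.sqrt (freqNormSq w) + 1 / Real.sqrt (freqNormSq z.1)) * ‖coordL R w y‖) :=
          mul_le_mul_of_nonneg_left h (by positivity)
      _ = 2 * Real.pi * ξ * (3 * (Real.sqrt (freqNormSq z.1) / Real.sqrt (freqNormSq w)) + 1) * ‖coordL R w y‖ := by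
          field_simp
      _ ≤ 2 * Real.pi * ξ * (3 * (1 + Real.sqrt (freqNormSq m)) + 1) * ‖coordL R w y‖ := by gcongr
      _ = 2 * Real.pi * ξ * (4 + 3 * Real.sqrt (freqNormSq m)) * ‖coordL R w y‖ := by ring
  · rw [coordL_apply_of_not_mem hw]
    simp

/-- **Projection-commutator group**:
`‖linkCoeffⱼ¹(z,t) • P_{k_z}(αⱼ(P_{k⁻}y⁻ − P_zP_{z−mⱼ}y⁻) + ᾱⱼ(P_{k⁺}y⁺ − P_zP_{z+mⱼ}y⁺))‖ ≤ 2πξ‖αⱼ‖(4 + 3|mⱼ|)(‖y⁻‖ + ‖y⁺‖)` (`2|ℓ| ≤ n`).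
[cite: Temam1984, Ch. III §1.1] [cite: MeshalkinSinai1961, pp. 1700–1705] -/
theorem norm_link_commutator_le (W₁ : LatticeWord k₀) {n : ℕ} (hn : n ≠ 0) {ℓ : Fin 3 → ℤ} (hℓ : 2 * Real.sqrt (freqNormSq ℓ) ≤ n) {R : ℕ}
    (j : Fin k₀) (t : ℝ) (y : Space R) (z : box R) :
    ‖linkCoeff W₁ 1 z.1 j t • transversalProj (classFreq n ℓ z.1)
        (slotAmp W₁ j • (transversalProj (classFreq n ℓ (z.1 - (W₁.phase j).m)) (coordL R (z.1 - (W₁.phase j).m) y) -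
            transversalProj z.1 (transversalProj (z.1 - (W₁.phase j).m) (coordL R (z.1 - (W₁.phase j).m) y))) +
          starRingEnd ℂ (slotAmp W₁ j) • (transversalProj (classFreq n ℓ (z.1 + (W₁.phase j).m)) (coordL R (z.1 + (W₁.phase j).m) y) -
            transversalProj z.1 (transversalProj (z.1 + (W₁.phase j).m) (coordL R (z.1 + (W₁.phase j).m) y))))‖ ≤
      2 * Real.pi * (Real.sqrt (freqNormSq ℓ) / n) * ‖slotAmp W₁ j‖ * (4 + 3 * Real.sqrt (freqNormSq (W₁.phase j).m)) *
        (‖coordL R (z.1 - (W₁.phase j).m) y‖ + ‖coordL R (z.1 + (W₁.phase j).m) y‖) := by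
  set m := (W₁.phase j).m with hm
  set α := slotAmp W₁ j with hαdef
  have hα : ‖starRingEnd ℂ α‖ = ‖α‖ := Complex.norm_conj _
  set T₁ := transversalProj (classFreq n ℓ z.1) (transversalProj (classFreq n ℓ (z.1 - m)) (coordL R (z.1 - m) y) -
    transversalProj z.1 (transversalProj (z.1 - m) (coordL R (z.1 - m) y))) with hT₁
  set T₂ := transversalProj (classFreq n ℓ z.1) (transversalProj (classFreq n ℓ (z.1 + m)) (coordL R (z.1 + m) y) -
    transversalProj z.1 (transversalProj (z.1 + m) (coordL R (z.1 + m) y))) with hT₂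
  have hlin : transversalProj (classFreq n ℓ z.1)
        (α • (transversalProj (classFreq n ℓ (z.1 - m)) (coordL R (z.1 - m) y) - transversalProj z.1 (transversalProj (z.1 - m) (coordL R (z.1 - m) y))) +
          starRingEnd ℂ α • (transversalProj (classFreq n ℓ (z.1 + m)) (coordL R (z.1 + m) y) -
            transversalProj z.1 (transversalProj (z.1 + m) (coordL R (z.1 + m) y))))
      = α • T₁ + starRingEnd ℂ α • T₂ := by
    rw [map_add, map_smul, map_smul]
  rw [hlin, norm_smul]
  have hlc := norm_linkCoeff_one_le W₁ z.1 j t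
  have h1 := norm_neighbour_commutator_le hn hℓ z (z.1 - m) m (Or.inl (by abel)) y
  have h2 := norm_neighbour_commutator_le hn hℓ z (z.1 + m) m (Or.inr (by abel)) y
  rw [← hT₁] at h1
  rw [← hT₂] at h2
  have hsum : ‖α • T₁ + starRingEnd ℂ α • T₂‖ ≤ ‖α‖ * (‖T₁‖ + ‖T₂‖) := by
    refine (norm_add_le _ _).trans ?_
    rw [norm_smul, norm_smul, hα, mul_add]
  have hK : 0 ≤ 2 * Real.pi * (Real.sqrt (freqNormSq ℓ) / n) * (4 + 3 * Real.sqrt (freqNormSq m)) := by positivity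
  calc ‖linkCoeff W₁ 1 z.1 j t‖ * ‖α • T₁ + starRingEnd ℂ α • T₂‖
      ≤ (2 * Real.pi * Real.sqrt (freqNormSq z.1)) * (‖α‖ * (‖T₁‖ + ‖T₂‖)) := mul_le_mul hlc hsum (norm_nonneg _) (by positivity)
    _ = ‖α‖ * (2 * Real.pi * Real.sqrt (freqNormSq z.1) * ‖T₁‖ + 2 * Real.pi * Real.sqrt (freqNormSq z.1) * ‖T₂‖) := by ring
    _ ≤ ‖α‖ * (2 * Real.pi * (Real.sqrt (freqNormSq ℓ) / n) * (4 + 3 * Real.sqrt (freqNormSq m)) * ‖coordL R (z.1 - m) y‖ +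
          2 * Real.pi * (Real.sqrt (freqNormSq ℓ) / n) * (4 + 3 * Real.sqrt (freqNormSq m)) * ‖coordL R (z.1 + m) y‖) := by
        gcongr
    _ = _ := by ring

end Summit.AnomalousDissipation.AnomalousDissipation.Theorems.SolenoidalFractalHomogenisation.LagrangianStep.Sideband

end
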